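import Literature.Probability.LatticeModels.DobrushinMetricInfiniteRange
import Literature.Probability.LatticeModels.ONModelDobrushinStates
import Mathlib.Analysis.SpecificLimits.Basic
import HarnessLib

/-!
# Dobrushin's comparison estimates in the Vasserstein form, infinite range with summable rows, V:
the sweep from a bounded ESTIMATE down to a bounded super-solution, and the estimate `R·𝟙_Λ` for a
finite-volume kernel and its tilt

Fifth file of the Vasserstein (Kantorovich–Rubinstein) form of Dobrushin's contraction technique, sequel of
`DobrushinMetricInfiniteRange.lean` (Föllmer's infinite index set `I`, summable rows `∑' y, C x y ≤ c < 1`, the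
global Lipschitz class `L(Ω)`). That file runs the comparison of two states invariant under the one-site operators
from the CONSTANT estimate `R` (Föllmer 1988, Ch. I, (2.22)), which is the right start for Gibbs measures. For the
conditional specification `π^{J,η}` of (2.10) — the kernels `γ_Λ(· | η)` of a finite volume `Λ = J` with the outside
frozen at `η` — both states to be compared freeze the outside of `Λ`, so the sharper start is the vector `R·𝟙_Λ`
("a uniformly bounded estimate `a = (a_k)` to start the argument in (2.5)", loc. cit. after (2.22)), and the comparison
has to be run from a general bounded estimate down to a bounded super-solution. This file supplies exactly that:

* the abstract layer from a GENERAL estimate `a₀ ∈ [0, B]`: the iterates stay in `[0, B]` (`iterate_phi_mem_of_le_tsum`), do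
  not move off the usable set `W` (`iterate_phi_apply_of_not_mem_tsum`), are estimates (`est_iterate_phi_tsum_of_estimate`,
  Lemma (2.5) applied successively) and satisfy `Φⁿ a₀ ≤ M cⁿ 𝟙_W + a⋆` for a bounded super-solution `a⋆` on `W` with
  `a₀ ≤ M 𝟙_W + a⋆` (`iterate_phi_le_of_superSolution_tsum`); hence the comparison estimate
  **`abs_sub_le_tsum_of_superSolution_of_estimate`**: `|E₁ F − E₂ F| ≤ ∑' y, a⋆ y δ y` ((2.8) run from (2.22));
* the kernel estimate **`abs_kernel_sub_tilt_le_tsum_indicator`**: for a finite volume `Λ`, a boundary condition `η`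
  and a nonnegative bounded density `g` with `γ_Λ(g|η) > 0`, the vector `R·𝟙_Λ` is an estimate for the pair
  `γ_Λ(·|η)`, `g γ_Λ(·|η)/γ_Λ(g|η)` on the global Lipschitz class (properness: both average over configurations equal
  to `η` off `Λ`).
The covariance estimate for the conditional specification built on these is the sequel
`DobrushinMetricInfiniteRangeKernel.lean`.

Theorems only: no definition, no named fact. The finite-range, finite-`nbr` analogue (estimates and super-solutions
for `DustingData`) is `DobrushinComparisonBoundary.lean`. NOT here: anything specific to a model.

## References

* H. Föllmer, *Random fields and diffusion processes*, LNM 1362 (1988), Ch. I §2: (2.3)–(2.5), Comparison Theorem (2.8),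
  (2.10) (conditional specification), Remark (2.17), (2.22).
* H.-O. Georgii, *Gibbs Measures and Phase Transitions*, 2nd ed. (2011), Def. 1.23, Thm. 8.20.
-/

noncomputable section

open MeasureTheory ProbabilityTheory Finset Function Filter
open scoped Topology

namespace Literature.Probability.LatticeModels

namespace DobrushinMetric

/-! ### The abstract layer from a general bounded estimate -/

section Abstract

variable {ι Ω : Type*} [DecidableEq ι]
variable {B : ℝ} {Adm : (Ω → ℝ) → Prop} {Lip : (Ω → ℝ) → (ι → ℝ) → Prop}
  {T : ι → (Ω → ℝ) → (Ω → ℝ)} {C : ι → ι → ℝ} {W : Set ι} {E₁ E₂ : (Ω → ℝ) → ℝ}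

omit [DecidableEq ι] in
/-- All iterates of the simultaneous update `Φ` started at a vector `a₀ ∈ [0, B]` lie in `[0, B]` when the rows are
`≤ c ≤ 1` on the usable sites (Föllmer 1988, Ch. I, proof of (2.8): the iterates of a bounded estimate stay bounded).
[cite: Follmer1988, Ch. I Comparison Theorem (2.8)] -/
theorem iterate_phi_mem_of_le_tsum [DecidablePred (· ∈ W)] (hC0 : ∀ x y, 0 ≤ C x y) (hCs : ∀ x, Summable (C x))
    {phi : (ι → ℝ) → ι → ℝ} (hphi : ∀ a y, phi a y = if y ∈ W then ∑' z, C y z * a z else a y)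
    {c : ℝ} (hc1 : c ≤ 1) (hrow : ∀ y ∈ W, ∑' z, C y z ≤ c) {a₀ : ι → ℝ} (ha0 : ∀ y, 0 ≤ a₀ y)
    (haB : ∀ y, a₀ y ≤ B) (n : ℕ) (y : ι) :
    0 ≤ phi^[n] a₀ y ∧ phi^[n] a₀ y ≤ B := by
  induction n generalizing y with
  | zero => exact ⟨ha0 y, haB y⟩
  | succ n ih =>
    rw [Function.iterate_succ_apply', hphi]
    split_ifs with hy
    · have hB : 0 ≤ B := (ha0 y).trans (haB y)
      refine ⟨tsum_nonneg fun z => mul_nonneg (hC0 y z) (ih z).1, ?_⟩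
      have hs : Summable fun z => C y z * phi^[n] a₀ z :=
        Summable.of_nonneg_of_le (fun z => mul_nonneg (hC0 y z) (ih z).1)
          (fun z => mul_le_mul_of_nonneg_left (ih z).2 (hC0 y z)) ((hCs y).mul_right B)
      calc ∑' z, C y z * phi^[n] a₀ z ≤ ∑' z, C y z * B :=
            hs.tsum_le_tsum (fun z => mul_le_mul_of_nonneg_left (ih z).2 (hC0 y z)) ((hCs y).mul_right B)
        _ = (∑' z, C y z) * B := tsum_mul_right
        _ ≤ 1 * B := mul_le_mul_of_nonneg_right ((hrow y hy).trans hc1) hB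
        _ = B := one_mul B
    · exact ih y

omit [DecidableEq ι] in
/-- Off the usable sites the iterates of `Φ` never move: `(Φⁿ a₀)_y = (a₀)_y` for `y ∉ W`.
[cite: Follmer1988, Ch. I Comparison Theorem (2.8)] -/
theorem iterate_phi_apply_of_not_mem_tsum [DecidablePred (· ∈ W)]
    {phi : (ι → ℝ) → ι → ℝ} (hphi : ∀ a y, phi a y = if y ∈ W then ∑' z, C y z * a z else a y)
    (a₀ : ι → ℝ) (n : ℕ) {y : ι} (hy : y ∉ W) : phi^[n] a₀ y = a₀ y := by
  induction n with
  | zero => rfl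
  | succ n ih => rw [Function.iterate_succ_apply', hphi, if_neg hy, ih]

omit [DecidableEq ι] in
/-- **The iterates from a bounded estimate are dominated by a super-solution plus a geometric term** (Föllmer 1988,
Ch. I, proof of (2.8) with the start (2.22)): if `a⋆ ≥ 0` is bounded with `∑' z, C y z a⋆ z ≤ a⋆ y` on `W`, the rows are
`≤ c ≤ 1` on `W`, and `a₀ ≤ M 𝟙_W + a⋆` with `a₀ ∈ [0, B]`, then `Φⁿ a₀ ≤ M cⁿ 𝟙_W + a⋆` for every `n`.
[cite: Follmer1988, Ch. I Comparison Theorem (2.8)] -/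
theorem iterate_phi_le_of_superSolution_tsum [DecidablePred (· ∈ W)] (hC0 : ∀ x y, 0 ≤ C x y)
    (hCs : ∀ x, Summable (C x))
    {phi : (ι → ℝ) → ι → ℝ} (hphi : ∀ a y, phi a y = if y ∈ W then ∑' z, C y z * a z else a y)
    {c : ℝ} (hc0 : 0 ≤ c) (hc1 : c ≤ 1) (hrow : ∀ y ∈ W, ∑' z, C y z ≤ c) {a₀ : ι → ℝ}
    (ha0 : ∀ y, 0 ≤ a₀ y) (haB : ∀ y, a₀ y ≤ B) {astar : ι → ℝ} (hs0 : ∀ y, 0 ≤ astar y) {Bs : ℝ}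
    (hsB : ∀ y, astar y ≤ Bs) (hsol : ∀ y ∈ W, ∑' z, C y z * astar z ≤ astar y) {M : ℝ} (hM : 0 ≤ M)
    (hinit : ∀ y, a₀ y ≤ M * W.indicator 1 y + astar y) (n : ℕ) (y : ι) :
    phi^[n] a₀ y ≤ M * c ^ n * W.indicator 1 y + astar y := by
  induction n generalizing y with
  | zero => simpa using hinit y
  | succ n ih =>
    by_cases hy : y ∈ W
    · rw [Function.iterate_succ_apply', hphi, if_pos hy, Set.indicator_of_mem hy, Pi.one_apply, mul_one]
      have hmem := iterate_phi_mem_of_le_tsum hC0 hCs hphi hc1 hrow ha0 haB n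
      have hs : Summable fun z => C y z * phi^[n] a₀ z :=
        Summable.of_nonneg_of_le (fun z => mul_nonneg (hC0 y z) (hmem z).1)
          (fun z => mul_le_mul_of_nonneg_left (hmem z).2 (hC0 y z)) ((hCs y).mul_right B)
      have hsa : Summable fun z => C y z * astar z :=
        Summable.of_nonneg_of_le (fun z => mul_nonneg (hC0 y z) (hs0 z))
          (fun z => mul_le_mul_of_nonneg_left (hsB z) (hC0 y z)) ((hCs y).mul_right Bs)
      have hs2 : Summable fun z => C y z * (M * c ^ n) + C y z * astar z := ((hCs y).mul_right _).add hsa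
      calc ∑' z, C y z * phi^[n] a₀ z
          ≤ ∑' z, (C y z * (M * c ^ n) + C y z * astar z) := by
            refine hs.tsum_le_tsum (fun z => ?_) hs2
            have hind : W.indicator (1 : ι → ℝ) z ≤ 1 := by
              by_cases hz : z ∈ W
              · rw [Set.indicator_of_mem hz, Pi.one_apply]
              · rw [Set.indicator_of_notMem hz]; exact zero_le_one
            have h2 : M * c ^ n * W.indicator 1 z ≤ M * c ^ n := by
              simpa using mul_le_mul_of_nonneg_left hind (mul_nonneg hM (pow_nonneg hc0 n))
            calc C y z * phi^[n] a₀ z ≤ C y z * (M * c ^ n * W.indicator 1 z + astar z) :=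
                  mul_le_mul_of_nonneg_left (ih z) (hC0 y z)
              _ ≤ C y z * (M * c ^ n + astar z) := mul_le_mul_of_nonneg_left (by linarith) (hC0 y z)
              _ = C y z * (M * c ^ n) + C y z * astar z := by ring
        _ = (∑' z, C y z) * (M * c ^ n) + ∑' z, C y z * astar z := by
            rw [((hCs y).mul_right _).tsum_add hsa, tsum_mul_right]
        _ ≤ c * (M * c ^ n) + astar y :=
            add_le_add (mul_le_mul_of_nonneg_right (hrow y hy) (mul_nonneg hM (pow_nonneg hc0 n)))
              (hsol y hy)
        _ = M * c ^ (n + 1) + astar y := by ring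
    · rw [iterate_phi_apply_of_not_mem_tsum hphi a₀ (n + 1) hy, Set.indicator_of_notMem hy, mul_zero, zero_add]
      have h := hinit y
      rw [Set.indicator_of_notMem hy, mul_zero, zero_add] at h
      exact h

/-- **All iterates `Φⁿ a₀` of a bounded estimate are estimates** (Föllmer 1988, Ch. I, Lemma (2.5) "applied
successively", started from a general uniformly bounded estimate `a₀` as in (2.22)), for two functionals invariant under
the usable one-site operators and summable rows `≤ c ≤ 1` on the usable sites.
[cite: Follmer1988, Ch. I Lemma (2.5)] -/
theorem est_iterate_phi_tsum_of_estimate [DecidablePred (· ∈ W)]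
    (hlip0 : ∀ ⦃F : Ω → ℝ⦄ ⦃δ : ι → ℝ⦄, Lip F δ → ∀ y, 0 ≤ δ y)
    (hlips : ∀ ⦃F : Ω → ℝ⦄ ⦃δ : ι → ℝ⦄, Lip F δ → Summable δ)
    (hC0 : ∀ x y, 0 ≤ C x y) (hCs : ∀ x, Summable (C x))
    (hT : ∀ ⦃F : Ω → ℝ⦄ (x : ι), Adm F → Adm (T x F))
    (hdust : ∀ ⦃F : Ω → ℝ⦄ ⦃δ : ι → ℝ⦄ (x : ι), Adm F → Lip F δ →
      Lip (T x F) fun y => if y = x then 0 else δ y + C x y * δ x)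
    (h₁T : ∀ ⦃F : Ω → ℝ⦄ (x : ι), x ∈ W → Adm F → E₁ (T x F) = E₁ F)
    (h₂T : ∀ ⦃F : Ω → ℝ⦄ (x : ι), x ∈ W → Adm F → E₂ (T x F) = E₂ F)
    {phi : (ι → ℝ) → ι → ℝ} (hphi : ∀ a y, phi a y = if y ∈ W then ∑' z, C y z * a z else a y)
    {c : ℝ} (hc1 : c ≤ 1) (hrow : ∀ y ∈ W, ∑' z, C y z ≤ c) {a₀ : ι → ℝ}
    (ha : ∀ ⦃F : Ω → ℝ⦄ ⦃δ : ι → ℝ⦄, Adm F → Lip F δ → |E₁ F - E₂ F| ≤ ∑' y, a₀ y * δ y)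
    (ha0 : ∀ y, 0 ≤ a₀ y) (haB : ∀ y, a₀ y ≤ B)
    (n : ℕ) ⦃F : Ω → ℝ⦄ ⦃δ : ι → ℝ⦄ (hF : Adm F) (hδ : Lip F δ) :
    |E₁ F - E₂ F| ≤ ∑' y, phi^[n] a₀ y * δ y := by
  induction n generalizing F δ with
  | zero => exact ha hF hδ
  | succ n ih =>
    rw [Function.iterate_succ_apply']
    have hmem := iterate_phi_mem_of_le_tsum hC0 hCs hphi hc1 hrow ha0 haB n
    have hmem' := iterate_phi_mem_of_le_tsum hC0 hCs hphi hc1 hrow ha0 haB (n + 1)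
    refine est_phi_tsum hlip0 hlips hC0 hCs hT hdust h₁T h₂T hphi ih (fun y => (hmem y).1)
      (fun y => (hmem y).2) (fun y => ?_) hF hδ
    have h := (hmem' y).2
    rwa [Function.iterate_succ_apply'] at h

/-- **Dobrushin's comparison estimate from a bounded estimate down to a bounded super-solution, summable rows,
Vasserstein form** (Föllmer 1988, Ch. I, Comparison Theorem (2.8) run from the uniformly bounded estimate of (2.22)):
for two functionals invariant under the usable one-site operators, summable rows `≤ c < 1` on `W`, an estimate
`a₀ ∈ [0, B]`, a bounded super-solution `a⋆ ≥ 0` on `W` (`∑' z, C y z a⋆ z ≤ a⋆ y`) and `M ≥ 0` with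
`a₀ ≤ M 𝟙_W + a⋆`: every admissible `F` with Lipschitz vector `δ` satisfies `|E₁ F − E₂ F| ≤ ∑' y, a⋆ y δ y`
(the iterates obey `Φⁿ a₀ ≤ M cⁿ 𝟙_W + a⋆`, and `M cⁿ ∑' δ → 0`).
[cite: Follmer1988, Ch. I Comparison Theorem (2.8)] -/
theorem abs_sub_le_tsum_of_superSolution_of_estimate
    (hlip0 : ∀ ⦃F : Ω → ℝ⦄ ⦃δ : ι → ℝ⦄, Lip F δ → ∀ y, 0 ≤ δ y)
    (hlips : ∀ ⦃F : Ω → ℝ⦄ ⦃δ : ι → ℝ⦄, Lip F δ → Summable δ)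
    (hC0 : ∀ x y, 0 ≤ C x y) (hCs : ∀ x, Summable (C x))
    (hT : ∀ ⦃F : Ω → ℝ⦄ (x : ι), Adm F → Adm (T x F))
    (hdust : ∀ ⦃F : Ω → ℝ⦄ ⦃δ : ι → ℝ⦄ (x : ι), Adm F → Lip F δ →
      Lip (T x F) fun y => if y = x then 0 else δ y + C x y * δ x)
    (h₁T : ∀ ⦃F : Ω → ℝ⦄ (x : ι), x ∈ W → Adm F → E₁ (T x F) = E₁ F)
    (h₂T : ∀ ⦃F : Ω → ℝ⦄ (x : ι), x ∈ W → Adm F → E₂ (T x F) = E₂ F)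
    {c : ℝ} (hc0 : 0 ≤ c) (hc1 : c < 1) (hrow : ∀ y ∈ W, ∑' z, C y z ≤ c) {a₀ : ι → ℝ}
    (ha : ∀ ⦃F : Ω → ℝ⦄ ⦃δ : ι → ℝ⦄, Adm F → Lip F δ → |E₁ F - E₂ F| ≤ ∑' y, a₀ y * δ y)
    (ha0 : ∀ y, 0 ≤ a₀ y) (haB : ∀ y, a₀ y ≤ B) {astar : ι → ℝ} (hs0 : ∀ y, 0 ≤ astar y) {Bs : ℝ}
    (hsB : ∀ y, astar y ≤ Bs) (hsol : ∀ y ∈ W, ∑' z, C y z * astar z ≤ astar y) {M : ℝ} (hM : 0 ≤ M)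
    (hinit : ∀ y, a₀ y ≤ M * W.indicator 1 y + astar y)
    ⦃F : Ω → ℝ⦄ ⦃δ : ι → ℝ⦄ (hF : Adm F) (hδ : Lip F δ) :
    |E₁ F - E₂ F| ≤ ∑' y, astar y * δ y := by
  classical
  set phi : (ι → ℝ) → ι → ℝ := fun a y => if y ∈ W then ∑' z, C y z * a z else a y with hphidef
  have hphi : ∀ a y, phi a y = if y ∈ W then ∑' z, C y z * a z else a y := fun _ _ => rfl
  have hδ0 := hlip0 hδ
  have hδs := hlips hδ
  have hsa : Summable fun y => astar y * δ y :=
    Summable.of_nonneg_of_le (fun y => mul_nonneg (hs0 y) (hδ0 y))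
      (fun y => mul_le_mul_of_nonneg_right (hsB y) (hδ0 y)) (hδs.mul_left Bs)
  have hB : ∀ n : ℕ, |E₁ F - E₂ F| ≤ M * c ^ n * ∑' y, δ y + ∑' y, astar y * δ y := fun n => by
    refine (est_iterate_phi_tsum_of_estimate hlip0 hlips hC0 hCs hT hdust h₁T h₂T hphi hc1.le hrow
      ha ha0 haB n hF hδ).trans ?_
    have hmem := iterate_phi_mem_of_le_tsum hC0 hCs hphi hc1.le hrow ha0 haB n
    have hs : Summable fun y => phi^[n] a₀ y * δ y :=
      Summable.of_nonneg_of_le (fun y => mul_nonneg (hmem y).1 (hδ0 y))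
        (fun y => mul_le_mul_of_nonneg_right (hmem y).2 (hδ0 y)) (hδs.mul_left B)
    rw [← tsum_mul_left, ← (hδs.mul_left (M * c ^ n)).tsum_add hsa]
    refine hs.tsum_le_tsum (fun y => ?_) ((hδs.mul_left (M * c ^ n)).add hsa)
    have h1 := iterate_phi_le_of_superSolution_tsum hC0 hCs hphi hc0 hc1.le hrow ha0 haB hs0 hsB hsol
      hM hinit n y
    have hind : W.indicator (1 : ι → ℝ) y ≤ 1 := by
      by_cases hy : y ∈ W
      · rw [Set.indicator_of_mem hy, Pi.one_apply]
      · rw [Set.indicator_of_notMem hy]; exact zero_le_one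
    have h2 : phi^[n] a₀ y ≤ M * c ^ n + astar y := by
      have := mul_le_mul_of_nonneg_left hind (mul_nonneg hM (pow_nonneg hc0 n))
      linarith
    calc phi^[n] a₀ y * δ y ≤ (M * c ^ n + astar y) * δ y := mul_le_mul_of_nonneg_right h2 (hδ0 y)
      _ = M * c ^ n * δ y + astar y * δ y := by ring
  have hlim : Tendsto (fun n : ℕ => M * c ^ n * ∑' y, δ y + ∑' y, astar y * δ y)
      atTop (𝓝 (M * 0 * ∑' y, δ y + ∑' y, astar y * δ y)) :=
    ((((tendsto_pow_atTop_nhds_zero_of_lt_one hc0 hc1).const_mul M).mul_const _).add_const _)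
  have h := ge_of_tendsto' hlim hB
  simpa using h

end Abstract

/-! ### The conditional specification: finite-volume kernels and their tilts -/

section Kernel

variable {V S : Type*} [MeasurableSpace S] {γ : Specification V S} {r : S → S → ℝ} {C : V → V → ℝ}

/-- **The initial estimate `R·𝟙_Λ` for a kernel and its tilt, global Lipschitz class** (Föllmer 1988, Ch. I, (2.3)
and (2.22) for the conditional specification (2.10)): for a finite volume `Λ`, a boundary condition `η`, a nonnegative
bounded measurable density `g` with `γ_Λ(g|η) > 0`, and a bounded measurable `F` with
`|F σ − F τ| ≤ ∑' y, δ y · r(σ y, τ y)` (`δ ≥ 0` summable, `0 ≤ r ≤ R`, `r a a = 0`):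
`|γ_Λ(F|η) − γ_Λ(g F|η)/γ_Λ(g|η)| ≤ ∑' y, R 𝟙[y ∈ Λ] δ y` — both functionals average over configurations equal to
`η` off `Λ` (properness), where `F` oscillates by at most `R ∑_{y ∈ Λ} δ y`. [cite: Follmer1988, Ch. I (2.10)] -/
theorem abs_kernel_sub_tilt_le_tsum_indicator [DecidableEq V] (hγ : IsSpecification γ)
    {R : ℝ} (hr0 : ∀ a b, 0 ≤ r a b) (hrR : ∀ a b, r a b ≤ R) (hR : 0 ≤ R) (hr00 : ∀ a, r a a = 0)
    (Λ : Finset V) (η : V → S) {g : (V → S) → ℝ} (hgm : Measurable g) (hg0 : ∀ σ, 0 ≤ g σ)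
    {Bg : ℝ} (hgB : ∀ σ, g σ ≤ Bg) (hgpos : 0 < ∫ σ, g σ ∂(γ Λ η))
    {F : (V → S) → ℝ} (hFm : Measurable F) {MF : ℝ} (hMF : ∀ σ, |F σ| ≤ MF)
    {δ : V → ℝ} (hδ0 : ∀ y, 0 ≤ δ y) (hδs : Summable δ)
    (hδ : ∀ σ τ, |F σ - F τ| ≤ ∑' y, δ y * r (σ y) (τ y)) :
    |(∫ σ, F σ ∂(γ Λ η)) - (∫ σ, g σ * F σ ∂(γ Λ η)) / ∫ σ, g σ ∂(γ Λ η)| ≤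
      ∑' y, (if y ∈ Λ then R else 0) * δ y := by
  haveI := hγ.isProbability Λ η
  -- the inside version of `F`
  set glue : (V → S) → V → S := fun σ z => if z ∈ Λ then σ z else η z with hglue
  set h : (V → S) → ℝ := fun σ => F (glue σ) with hh
  have hglm : Measurable glue := by
    refine measurable_pi_iff.2 fun z => ?_
    by_cases hz : z ∈ Λ
    · simp only [hglue, if_pos hz]; exact measurable_pi_apply z
    · simp only [hglue, if_neg hz]; exact measurable_const
  have hhm : Measurable h := hFm.comp hglm
  have hhB : ∀ σ, |h σ| ≤ MF := fun σ => hMF _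
  have hgabs : ∀ σ, |g σ| ≤ Bg := fun σ => by rw [abs_of_nonneg (hg0 σ)]; exact hgB σ
  have hgi : Integrable g (γ Λ η) := integrable_of_abs_le' hgm hgabs
  have hhi : Integrable h (γ Λ η) := integrable_of_abs_le' hhm hhB
  have hghi : Integrable (fun σ => g σ * h σ) (γ Λ η) :=
    hgi.mul_bdd hhm.aestronglyMeasurable (ae_of_all _ fun σ => by
      rw [Real.norm_eq_abs]; exact hhB σ)
  -- properness: `F = h` a.e. under the kernel
  have hFh : ∀ᵐ σ ∂(γ Λ η), F σ = h σ := by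
    filter_upwards [hγ.proper Λ η] with σ hσ
    simp only [hh]; congr 1; funext z
    by_cases hz : z ∈ Λ
    · simp only [hglue, if_pos hz]
    · simp only [hglue, if_neg hz]; exact hσ z hz
  have h1 : ∫ σ, F σ ∂(γ Λ η) = ∫ σ, h σ ∂(γ Λ η) := integral_congr_ae hFh
  have h2 : ∫ σ, g σ * F σ ∂(γ Λ η) = ∫ σ, g σ * h σ ∂(γ Λ η) :=
    integral_congr_ae (by filter_upwards [hFh] with σ hσ; rw [hσ])
  -- the oscillation of the inside function
  set K : ℝ := ∑' y, (if y ∈ Λ then R else 0) * δ y with hK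
  have hsK : Summable fun y => (if y ∈ Λ then R else 0) * δ y :=
    Summable.of_nonneg_of_le (fun y => mul_nonneg (by split_ifs; exacts [hR, le_rfl]) (hδ0 y))
      (fun y => mul_le_mul_of_nonneg_right (by split_ifs; exacts [le_rfl, hR]) (hδ0 y)) (hδs.mul_left R)
  have hosc : ∀ σ τ, |h σ - h τ| ≤ K := by
    intro σ τ
    refine (hδ (glue σ) (glue τ)).trans ?_
    have hs : Summable fun y => δ y * r (glue σ y) (glue τ y) :=
      Summable.of_nonneg_of_le (fun y => mul_nonneg (hδ0 y) (hr0 _ _))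
        (fun y => mul_le_mul_of_nonneg_left (hrR _ _) (hδ0 y)) (hδs.mul_right R)
    refine hs.tsum_le_tsum (fun y => ?_) hsK
    by_cases hy : y ∈ Λ
    · rw [if_pos hy, mul_comm]
      exact mul_le_mul_of_nonneg_right (hrR _ _) (hδ0 y)
    · simp only [hglue, if_neg hy, hr00, mul_zero, zero_mul, le_refl]
  -- the two averages of `h` lie within `K` of `h τ` for every `τ`
  have hup : ∀ τ, (∫ σ, h σ ∂(γ Λ η)) ≤ h τ + K := fun τ =>
    calc ∫ σ, h σ ∂(γ Λ η) ≤ ∫ _σ, h τ + K ∂(γ Λ η) :=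
          integral_mono hhi (integrable_const _) fun σ => by linarith [(abs_le.1 (hosc σ τ)).2]
      _ = h τ + K := by simp
  have hdown : ∀ τ, h τ - K ≤ ∫ σ, h σ ∂(γ Λ η) := fun τ =>
    calc h τ - K = ∫ _σ, h τ - K ∂(γ Λ η) := by simp
      _ ≤ ∫ σ, h σ ∂(γ Λ η) :=
          integral_mono (integrable_const _) hhi fun σ => by linarith [(abs_le.1 (hosc τ σ)).2]
  have hE2up : (∫ σ, g σ * h σ ∂(γ Λ η)) / ∫ σ, g σ ∂(γ Λ η) ≤ (∫ σ, h σ ∂(γ Λ η)) + K := by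
    rw [div_le_iff₀ hgpos]
    calc ∫ σ, g σ * h σ ∂(γ Λ η) ≤ ∫ σ, g σ * ((∫ σ, h σ ∂(γ Λ η)) + K) ∂(γ Λ η) :=
          integral_mono hghi (hgi.mul_const _) fun τ =>
            mul_le_mul_of_nonneg_left (by linarith [hdown τ]) (hg0 τ)
      _ = ((∫ σ, h σ ∂(γ Λ η)) + K) * ∫ σ, g σ ∂(γ Λ η) := by rw [integral_mul_const, mul_comm]
  have hE2down : (∫ σ, h σ ∂(γ Λ η)) - K ≤ (∫ σ, g σ * h σ ∂(γ Λ η)) / ∫ σ, g σ ∂(γ Λ η) := by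
    rw [le_div_iff₀ hgpos]
    calc ((∫ σ, h σ ∂(γ Λ η)) - K) * ∫ σ, g σ ∂(γ Λ η)
        = ∫ σ, g σ * ((∫ σ, h σ ∂(γ Λ η)) - K) ∂(γ Λ η) := by rw [integral_mul_const, mul_comm]
      _ ≤ ∫ σ, g σ * h σ ∂(γ Λ η) :=
          integral_mono (hgi.mul_const _) hghi fun τ =>
            mul_le_mul_of_nonneg_left (by linarith [hup τ]) (hg0 τ)
  rw [h1, h2, abs_le]
  constructor <;> linarith

end Kernel

end DobrushinMetric

end Literature.Probability.LatticeModels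

end
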